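import Summits.BirchSwinnertonDyer.BirchSwinnertonDyer.Theorems.ClassRecordThreeOpenValueReciprocityOfArchimedean
import Summits.BirchSwinnertonDyer.BirchSwinnertonDyer.Theorems.ClassRecordThreeHsiehDescentOfValueReciprocityB
import Literature.NumberTheory.EllipticCurves.BDPCentralValueReciprocity
import HarnessLib

/-!
# Routes `ClassRecordThree` ∕ `KolyvaginRoadThree`: item stmt-BirchSwinnertonDyer-19281 `OpenValueReciprocityAtThree`
# (SHARP K5-B) from ONE Literature named fact, and the parent crux `HsiehDescentAtThree` (item 19108) from TWO

Cell `bsd-stepL` (run/shared/lean/pub/bsd-stepL/), seat `bsd-stepL-desc3-p1` (D-0074 hand), `--supports stmt-BirchSwinnertonDyer-19281`.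

The archimedean K5-B is now the tree's named fact
`Literature.NumberTheory.EllipticCurves.bertoliniDarmonPrasanna2013_centralValue_reciprocity` (p419864, reviewed:
Bertolini–Darmon–Prasanna 2013 Thm. 5.5 with its proof (5.1.16), Prop. 1.12 (1), Lemma 5.3 (3) — `Aut(ℂ/F)`-reciprocity of
`L(f/K, χ, 1)/(π^{2n+1}Ω^{4n})`, `F ⊇ K` unramified above every odd prime split in `K`, `d_K` odd, every `q ∣ N` split). This
file composes it with the landed glue:

* `openValueReciprocityAtThree_of_bdp2013` — **item 19281 `Theses.ClassRecordThree.OpenValueReciprocityAtThree` from the ONE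
  named fact** (by `openValueReciprocityAtThree_of_archimedeanReciprocity`, p420148: T6-OPEN p418539 + x11b3-p1's dictionary);
  `kolyvaginRoadThree_openValueReciprocityAtThree_of_bdp2013` the shared copy; `valueReciprocityBAtThree_of_bdp2013` the
  by-name form `∀ W, Theorems.ValueReciprocityBAtThree W` (bdp g10, p417714).
* `classRecordThree_hsiehDescentAtThree_of_tateSen_of_bdp2013` ∕ `kolyvaginRoadThree_hsiehDescentAtThree_of_tateSen_of_bdp2013` —
  **the parent crux `HsiehDescentAtThree` (item 19108) from exactly TWO Literature named facts**:
  `PAdicHodge.TateSenCharacterVanishing 3` (Brinon–Conrad Thm. 2.2.7; p414875) and the BDP13 reciprocity fact — via bdp g10's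
  SHARP reduction `classRecordThree_hsiehDescentAtThree_of_tateSen_of_valueReciprocityB` (p418455 ← p417285).

HONEST FRAMING: CONDITIONAL results — both hypotheses are PUBLISHED theorems carried as named facts (not discharged in the
tree: Tate–Sen needs the `SenFiniteness` transport, BDP13 Thm. 5.5 needs CM test triples ∕ Shimura's algebraicity of
nearly-holomorphic CM values); items 19281 ∕ 19108 are NOT closed by these theorems (conditional-result); the node
`Three.HsiehDescentAt₃` is untouched; nothing booked (T7). This is the kernel price of H1@3 of record (TARGET §1.1): {two
Literature named facts}, now IN THE TREE. What this is NOT: not BSD; not a statement at even `d_K` or at `p ≥ 5`.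

References: [BertoliniDarmonPrasanna2013] Thm. 5.5, (5.1.16), Prop. 1.12 (1), Lemma 5.3; [BrinonConrad2009] Thm. 2.2.7;
[Hsieh2014] Thm. A; [CastellaHsieh2018] §3.3; cell memo PROOF-BDP §18–§19, §26.
-/

noncomputable section

open Literature.NumberTheory.EllipticCurves (bertoliniDarmonPrasanna2013_centralValue_reciprocity)
open Literature.NumberTheory.PAdicHodge (TateSenCharacterVanishing)

namespace Summit.BirchSwinnertonDyer.BirchSwinnertonDyer.Theorems

/-- **Item `stmt-BirchSwinnertonDyer-19281` (`OpenValueReciprocityAtThree`, SHARP K5-B) from the ONE named fact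
`bertoliniDarmonPrasanna2013_centralValue_reciprocity`** (BDP13 Thm. 5.5 ∕ (5.1.16) ∕ Prop. 1.12 (1) ∕ Lemma 5.3 (3)), by the
landed glue `openValueReciprocityAtThree_of_archimedeanReciprocity` (T6-OPEN + the value dictionary). CONDITIONAL on that
fact; the item is not closed by this theorem. [cite: BertoliniDarmonPrasanna2013, Thm. 5.5 and (5.1.16) (p. 60)] -/
theorem openValueReciprocityAtThree_of_bdp2013 (h : bertoliniDarmonPrasanna2013_centralValue_reciprocity) :
    Summit.BirchSwinnertonDyer.BirchSwinnertonDyer.Theses.ClassRecordThree.OpenValueReciprocityAtThree :=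
  openValueReciprocityAtThree_of_archimedeanReciprocity h

/-- **The KolyvaginRoadThree copy of item 19281 from the ONE named fact** (same proposition; shared item).
[cite: BertoliniDarmonPrasanna2013, Thm. 5.5 and (5.1.16) (p. 60)] -/
theorem kolyvaginRoadThree_openValueReciprocityAtThree_of_bdp2013 (h : bertoliniDarmonPrasanna2013_centralValue_reciprocity) :
    Summit.BirchSwinnertonDyer.BirchSwinnertonDyer.Theses.KolyvaginRoadThree.OpenValueReciprocityAtThree :=
  openValueReciprocityAtThree_of_archimedeanReciprocity h

/-- **By name: `∀ W, Theorems.ValueReciprocityBAtThree W` from the ONE named fact.**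
[cite: BertoliniDarmonPrasanna2013, Thm. 5.5 and (5.1.16) (p. 60)] -/
theorem valueReciprocityBAtThree_of_bdp2013 (h : bertoliniDarmonPrasanna2013_centralValue_reciprocity) :
    ∀ (W : WeierstrassCurve ℚ) [W.IsElliptic] [W.IsGloballyMinimal], ValueReciprocityBAtThree W :=
  openValueReciprocityAtThree_of_archimedeanReciprocity h

/-- **The parent crux `Theses.ClassRecordThree.HsiehDescentAtThree` (item 19108) from exactly TWO Literature named facts**:
the printed Tate–Sen vanishing at `3` (`TateSenCharacterVanishing 3`, Brinon–Conrad Thm. 2.2.7) and the BDP13 reciprocity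
fact — bdp g10's SHARP reduction `classRecordThree_hsiehDescentAtThree_of_tateSen_of_valueReciprocityB` fed by
`valueReciprocityBAtThree_of_bdp2013`. CONDITIONAL on the two facts; the item is not closed by this theorem.
[cite: BrinonConrad2009, Thm. 2.2.7] [cite: BertoliniDarmonPrasanna2013, Thm. 5.5 and (5.1.16) (p. 60)] -/
theorem classRecordThree_hsiehDescentAtThree_of_tateSen_of_bdp2013 (hTS : TateSenCharacterVanishing 3)
    (hBDP : bertoliniDarmonPrasanna2013_centralValue_reciprocity) :
    Summit.BirchSwinnertonDyer.BirchSwinnertonDyer.Theses.ClassRecordThree.HsiehDescentAtThree :=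
  classRecordThree_hsiehDescentAtThree_of_tateSen_of_valueReciprocityB hTS (valueReciprocityBAtThree_of_bdp2013 hBDP)

/-- **The KolyvaginRoadThree copy of the parent crux from the same TWO named facts.**
[cite: BrinonConrad2009, Thm. 2.2.7] [cite: BertoliniDarmonPrasanna2013, Thm. 5.5 and (5.1.16) (p. 60)] -/
theorem kolyvaginRoadThree_hsiehDescentAtThree_of_tateSen_of_bdp2013 (hTS : TateSenCharacterVanishing 3)
    (hBDP : bertoliniDarmonPrasanna2013_centralValue_reciprocity) :
    Summit.BirchSwinnertonDyer.BirchSwinnertonDyer.Theses.KolyvaginRoadThree.HsiehDescentAtThree :=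
  kolyvaginRoadThree_hsiehDescentAtThree_of_tateSen_of_valueReciprocityB hTS (valueReciprocityBAtThree_of_bdp2013 hBDP)

end Summit.BirchSwinnertonDyer.BirchSwinnertonDyer.Theorems

end
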